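import Mathlib
import HarnessLib
import Summits.HubbardSuperconductivity.HubbardSuperconductivity.Theorems.KLProgrammeKLRegimeEngineTowerSplitCountRate

/-!
# Route `KLProgramme` — crux K3 ENGINE (stmt-HubbardSuperconductivity-20437 `KLRegimeEngineV17F2`), stub (b) v2, THE LEVELS PACKAGE (ℓ):
# the blocked-tower bookkeeping, part 7′ — READ-OUT re-measurement (jump ≥ 0) with the split count at track-dependent rates
# (cell gate-hubbard-kl, seat gate-hubbard-kl-p4 g13; companion of parts 8′ `…TowerSplitCountRate` / 9′ `…TowerBookkeepingTracks`)

Part 7 (`…EngineTowerReadout`, `towerReadoutMeasured_le`) re-measures the born profile at a boundary itself or inside the following block (jump `≥ 0`,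
no gain on the newest increment) with ONE row at the one-leg-pinned rate `g^{(m−2)(k−k′)}`.  The levelled read-out (every track `t`, E1-LEVELS-BLUEPRINT
(I6)) needs the same with the umklapp SPLIT (off-class row on the track's own born sizes, on-class row on the top track's born sizes with the absolute-level
weight `h^{k′}`) and at the track's own rate `r^{(a·m − b)·jump}` (part 8′).  With jump `≥ 0` no rate is gained, only the geometric sums over older
increments remain:

* **`towerReadoutMeasured_le_split_rate`** — `μ k m ≤ Σ_{k′≤k} c₁ c₂^m r^{(a m − b)(k−k′)} bb k′ m + Σ_{k′≤k} c₃ c₂^m r^{(a m − b′)(k−k′)} h^{k′} b₂ k′ m`, both born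
  profiles `≤ A λ^{m−1} Q^m`, `b + 1 ≤ 3a` ⇒ `μ k m ≤ (c₁/(1−r) + c₃/(1−h)) · A · λ^{m−1} · (c₂ Q)^m` (`3 ≤ m ≤ D`);
* **`towerReadoutMeasured_three_le_split`** — six legs: `μ k 3 ≤ Σ c₁ c₂³ g₃^{k−k′} bb k′ 3 + Σ c₃ c₂³ h^{k′} b₂ k′ 3` ⇒ `μ k 3 ≤ (c₁/(1−g₃) + c₃/(1−h))·c₂³·A·Q³·λ²`.
These are the per-track `hprof`/`hι₃` inputs of part 7's `towerReadout_le` at a read-out level.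
Pure real analysis; nothing about the model is asserted; nothing asserts superconductivity.
References: Benfatto–Giuliani–Mastropietro 2006 §2.8 (2.83), (2.93)–(2.98) [cite: BenfattoGiulianiMastropietro2006].
-/

noncomputable section

namespace Summit.HubbardSuperconductivity.HubbardSuperconductivity.Theorems.EngineV8

set_option linter.dupNamespace false -- summit = problem name (single-conjunct summit), D-0017

open Real Finset

/-- `Σ_{k′ ≤ k} r^{k − k′} ≤ 1/(1−r)` for `0 ≤ r < 1`. [folklore] -/
theorem sum_range_pow_sub_le_inv_one_sub {r : ℝ} (hr0 : 0 ≤ r) (hr1 : r < 1) (k : ℕ) :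
    ∑ k' ∈ range (k + 1), r ^ (k - k') ≤ 1 / (1 - r) := by
  have hrefl := sum_range_reflect (fun t => r ^ t) (k + 1)
  have : ∑ k' ∈ range (k + 1), r ^ (k - k') = ∑ t ∈ range (k + 1), r ^ t := by
    rw [← hrefl]
    refine sum_congr rfl fun j _ => ?_
    simp only [Nat.add_sub_cancel]
  rw [this]
  exact sum_range_pow_le_inv_one_sub hr0 hr1 k

/-- **(T1′-rate, split) Read-out re-measurement (jump ≥ 0) with the split count at a track-dependent rate.**  Off-class row
`Σ_{k′≤k} c₁ c₂^m r^{(a m − b)(k−k′)} bb k′ m` on the track's own born sizes, on-class row `Σ_{k′≤k} c₃ c₂^m r^{(a m − b′)(k−k′)} h^{k′} b₂ k′ m` on the top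
track's; both born profiles `≤ A λ^{m−1} Q^m` (`k′ ≤ k`, `3 ≤ m ≤ D`), `b + 1 ≤ 3a`, `0 < r < 1`, `0 ≤ h < 1`.  Then
`μ k m ≤ (c₁/(1−r) + c₃/(1−h)) · A · λ^{m−1} · (c₂ Q)^m` — the profile part 7's `towerReadout_le` consumes (`A″ := (c₁/(1−r) + c₃/(1−h))·A`, `Q″ := c₂Q`).
[cite: BenfattoGiulianiMastropietro2006, §2.8 (2.83), (2.93)-(2.98)] -/
theorem towerReadoutMeasured_le_split_rate {D a b b' : ℕ} {bb b₂ μ : ℕ → ℕ → ℝ} {A lam Q r h c₁ c₂ c₃ : ℝ}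
    (hA : 0 ≤ A) (hlam : 0 ≤ lam) (hQ : 0 ≤ Q) (hr0 : 0 < r) (hr1 : r < 1) (hh0 : 0 ≤ h) (hh1 : h < 1) (hc₁ : 0 ≤ c₁) (hc₂ : 0 ≤ c₂)
    (hc₃ : 0 ≤ c₃) (hab : b + 1 ≤ 3 * a) (hb0 : ∀ k m, 0 ≤ bb k m) (hb₂0 : ∀ k m, 0 ≤ b₂ k m) {k : ℕ}
    (hμ : ∀ m, 3 ≤ m → m ≤ D → μ k m ≤
      ∑ k' ∈ range (k + 1), c₁ * c₂ ^ m * r ^ ((a * m - b) * (k - k')) * bb k' m +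
        ∑ k' ∈ range (k + 1), c₃ * c₂ ^ m * r ^ ((a * m - b') * (k - k')) * h ^ k' * b₂ k' m)
    (hborn : ∀ k' ≤ k, ∀ m, 3 ≤ m → m ≤ D → bb k' m ≤ A * lam ^ (m - 1) * Q ^ m)
    (hborn₂ : ∀ k' ≤ k, ∀ m, 3 ≤ m → m ≤ D → b₂ k' m ≤ A * lam ^ (m - 1) * Q ^ m)
    {m : ℕ} (hm : 3 ≤ m) (hmD : m ≤ D) :
    μ k m ≤ (c₁ / (1 - r) + c₃ / (1 - h)) * A * lam ^ (m - 1) * (c₂ * Q) ^ m := by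
  have hr1' : 0 < 1 - r := sub_pos.2 hr1
  have hh1' : 0 < 1 - h := sub_pos.2 hh1
  have ham : 1 ≤ a * m - b := by
    have : b + 1 ≤ a * m := hab.trans (by nlinarith)
    omega
  refine (hμ m hm hmD).trans ?_
  -- off-class row: `r^{(am-b)(k-k')} ≤ r^{k-k'}`, `Σ r^{k-k'} ≤ 1/(1-r)`
  have hoff : ∑ k' ∈ range (k + 1), c₁ * c₂ ^ m * r ^ ((a * m - b) * (k - k')) * bb k' m ≤
      c₁ / (1 - r) * A * lam ^ (m - 1) * (c₂ * Q) ^ m := by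
    have hterm : ∀ k' ∈ range (k + 1), c₁ * c₂ ^ m * r ^ ((a * m - b) * (k - k')) * bb k' m ≤
        (c₁ * c₂ ^ m * (A * lam ^ (m - 1) * Q ^ m)) * r ^ (k - k') := by
      intro k' hk'
      have hk'le : k' ≤ k := Nat.lt_succ_iff.1 (mem_range.1 hk')
      have hpow : r ^ ((a * m - b) * (k - k')) ≤ r ^ (k - k') :=
        pow_le_pow_of_le_one hr0.le hr1.le (Nat.le_mul_of_pos_left _ (by omega))
      have := hborn k' hk'le m hm hmD
      have := hb0 k' m
      calc c₁ * c₂ ^ m * r ^ ((a * m - b) * (k - k')) * bb k' m ≤ c₁ * c₂ ^ m * r ^ (k - k') * (A * lam ^ (m - 1) * Q ^ m) := by gcongr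
        _ = _ := by ring
    refine (sum_le_sum hterm).trans ?_
    rw [← mul_sum]
    calc c₁ * c₂ ^ m * (A * lam ^ (m - 1) * Q ^ m) * ∑ k' ∈ range (k + 1), r ^ (k - k')
        ≤ c₁ * c₂ ^ m * (A * lam ^ (m - 1) * Q ^ m) * (1 / (1 - r)) :=
          mul_le_mul_of_nonneg_left (sum_range_pow_sub_le_inv_one_sub hr0.le hr1 k) (by positivity)
      _ = c₁ / (1 - r) * A * lam ^ (m - 1) * (c₂ * Q) ^ m := by rw [mul_pow]; field_simp
  -- on-class row: `r^{(am-b')(k-k')} ≤ 1`, `Σ h^{k'} ≤ 1/(1-h)`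
  have hon : ∑ k' ∈ range (k + 1), c₃ * c₂ ^ m * r ^ ((a * m - b') * (k - k')) * h ^ k' * b₂ k' m ≤
      c₃ / (1 - h) * A * lam ^ (m - 1) * (c₂ * Q) ^ m := by
    have hterm : ∀ k' ∈ range (k + 1), c₃ * c₂ ^ m * r ^ ((a * m - b') * (k - k')) * h ^ k' * b₂ k' m ≤
        (c₃ * c₂ ^ m * (A * lam ^ (m - 1) * Q ^ m)) * h ^ k' := by
      intro k' hk'
      have hk'le : k' ≤ k := Nat.lt_succ_iff.1 (mem_range.1 hk')
      have hpow : r ^ ((a * m - b') * (k - k')) ≤ 1 := pow_le_one₀ hr0.le hr1.le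
      have := hborn₂ k' hk'le m hm hmD
      have := hb₂0 k' m
      calc c₃ * c₂ ^ m * r ^ ((a * m - b') * (k - k')) * h ^ k' * b₂ k' m ≤ c₃ * c₂ ^ m * 1 * h ^ k' * (A * lam ^ (m - 1) * Q ^ m) := by
            gcongr
        _ = _ := by ring
    refine (sum_le_sum hterm).trans ?_
    rw [← mul_sum]
    calc c₃ * c₂ ^ m * (A * lam ^ (m - 1) * Q ^ m) * ∑ k' ∈ range (k + 1), h ^ k'
        ≤ c₃ * c₂ ^ m * (A * lam ^ (m - 1) * Q ^ m) * (1 / (1 - h)) :=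
          mul_le_mul_of_nonneg_left (sum_range_pow_le_inv_one_sub hh0 hh1 k) (by positivity)
      _ = c₃ / (1 - h) * A * lam ^ (m - 1) * (c₂ * Q) ^ m := by rw [mul_pow]; field_simp
  calc _ ≤ c₁ / (1 - r) * A * lam ^ (m - 1) * (c₂ * Q) ^ m + c₃ / (1 - h) * A * lam ^ (m - 1) * (c₂ * Q) ^ m := add_le_add hoff hon
    _ = _ := by ring

/-- **Six-leg read-out re-measurement (jump ≥ 0), two rows**: off-class at ratio `g₃^{k−k′}` on the track's own born sizes, on-class with the absolute-level
weight `h^{k′}` on the top track's; both `≤ A λ² Q³` for `k′ ≤ k` ⇒ `μ k 3 ≤ (c₁/(1−g₃) + c₃/(1−h))·c₂³·A·Q³·λ²` — the `ι₃` input of part 7's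
`towerReadout_le` at a read-out level. [cite: BenfattoGiulianiMastropietro2006, §2.8 (2.83), (2.93)-(2.98)] -/
theorem towerReadoutMeasured_three_le_split {bb b₂ μ : ℕ → ℕ → ℝ} {A Q g₃ h c₁ c₂ c₃ lam : ℝ}
    (hA : 0 ≤ A) (hQ : 0 ≤ Q) (hg0 : 0 ≤ g₃) (hg1 : g₃ < 1) (hh0 : 0 ≤ h) (hh1 : h < 1) (hc₁ : 0 ≤ c₁) (hc₂ : 0 ≤ c₂) (hc₃ : 0 ≤ c₃)
    (hb0 : ∀ k m, 0 ≤ bb k m) (hb₂0 : ∀ k m, 0 ≤ b₂ k m) {k : ℕ}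
    (hμ : μ k 3 ≤ ∑ k' ∈ range (k + 1), c₁ * c₂ ^ 3 * g₃ ^ (k - k') * bb k' 3 + ∑ k' ∈ range (k + 1), c₃ * c₂ ^ 3 * h ^ k' * b₂ k' 3)
    (hborn : ∀ k' ≤ k, bb k' 3 ≤ A * lam ^ 2 * Q ^ 3) (hborn₂ : ∀ k' ≤ k, b₂ k' 3 ≤ A * lam ^ 2 * Q ^ 3) :
    μ k 3 ≤ (c₁ * (1 / (1 - g₃)) + c₃ * (1 / (1 - h))) * c₂ ^ 3 * A * Q ^ 3 * lam ^ 2 := by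
  have hg1' : 0 < 1 - g₃ := sub_pos.2 hg1
  have hh1' : 0 < 1 - h := sub_pos.2 hh1
  refine hμ.trans ?_
  have hoff : ∑ k' ∈ range (k + 1), c₁ * c₂ ^ 3 * g₃ ^ (k - k') * bb k' 3 ≤ c₁ * c₂ ^ 3 * A * Q ^ 3 * (1 / (1 - g₃)) * lam ^ 2 := by
    have hterm : ∀ k' ∈ range (k + 1), c₁ * c₂ ^ 3 * g₃ ^ (k - k') * bb k' 3 ≤ (c₁ * c₂ ^ 3 * (A * lam ^ 2 * Q ^ 3)) * g₃ ^ (k - k') := by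
      intro k' hk'
      have := hborn k' (Nat.lt_succ_iff.1 (mem_range.1 hk'))
      have := hb0 k' 3
      calc c₁ * c₂ ^ 3 * g₃ ^ (k - k') * bb k' 3 ≤ c₁ * c₂ ^ 3 * g₃ ^ (k - k') * (A * lam ^ 2 * Q ^ 3) := by gcongr
        _ = _ := by ring
    refine (sum_le_sum hterm).trans ?_
    rw [← mul_sum]
    calc c₁ * c₂ ^ 3 * (A * lam ^ 2 * Q ^ 3) * ∑ k' ∈ range (k + 1), g₃ ^ (k - k')
        ≤ c₁ * c₂ ^ 3 * (A * lam ^ 2 * Q ^ 3) * (1 / (1 - g₃)) :=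
          mul_le_mul_of_nonneg_left (sum_range_pow_sub_le_inv_one_sub hg0 hg1 k) (by positivity)
      _ = _ := by ring
  have hon : ∑ k' ∈ range (k + 1), c₃ * c₂ ^ 3 * h ^ k' * b₂ k' 3 ≤ c₃ * c₂ ^ 3 * A * Q ^ 3 * (1 / (1 - h)) * lam ^ 2 := by
    have hterm : ∀ k' ∈ range (k + 1), c₃ * c₂ ^ 3 * h ^ k' * b₂ k' 3 ≤ (c₃ * c₂ ^ 3 * (A * lam ^ 2 * Q ^ 3)) * h ^ k' := by
      intro k' hk'
      have := hborn₂ k' (Nat.lt_succ_iff.1 (mem_range.1 hk'))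
      have := hb₂0 k' 3
      calc c₃ * c₂ ^ 3 * h ^ k' * b₂ k' 3 ≤ c₃ * c₂ ^ 3 * h ^ k' * (A * lam ^ 2 * Q ^ 3) := by gcongr
        _ = _ := by ring
    refine (sum_le_sum hterm).trans ?_
    rw [← mul_sum]
    calc c₃ * c₂ ^ 3 * (A * lam ^ 2 * Q ^ 3) * ∑ k' ∈ range (k + 1), h ^ k'
        ≤ c₃ * c₂ ^ 3 * (A * lam ^ 2 * Q ^ 3) * (1 / (1 - h)) :=
          mul_le_mul_of_nonneg_left (sum_range_pow_le_inv_one_sub hh0 hh1 k) (by positivity)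
      _ = _ := by ring
  calc _ ≤ c₁ * c₂ ^ 3 * A * Q ^ 3 * (1 / (1 - g₃)) * lam ^ 2 + c₃ * c₂ ^ 3 * A * Q ^ 3 * (1 / (1 - h)) * lam ^ 2 := add_le_add hoff hon
    _ = _ := by ring

end Summit.HubbardSuperconductivity.HubbardSuperconductivity.Theorems.EngineV8

end
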